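import Literature.MathematicalPhysics.QuantumFieldTheory.Balaban1983to89.B4Ineq45Decoupling
import Literature.MathematicalPhysics.QuantumFieldTheory.Balaban1983to89.B4Eq16GreenExists
import Literature.MathematicalPhysics.QuantumFieldTheory.Balaban1983to89.B4Prop31Holonomy

/-!
# `Balaban1983to89.B4Ineq46Lattice` — [Balaban1983RegularityDecay] pp. 589–590: THE `2d` PARITY MATCHINGS `B_i` OF THE
# BONDS OF `Ω^{(k)} ⊂ ℤ^d`, THE DECOUPLING INEQUALITY (4.6) AS PRINTED (constant `1/2d`, sum over ALL bonds of `Ω^{(k)}`),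
# AND THE REDUCTION «to prove (1.18) it is sufficient to prove (4.7) … γ₀ = ½ min{γ₀′/2d, a_k/(a_k + O(1))}»

statement-level skeleton of published theorems with citation tags; proofs where landed; nothing here is a claim about the Yang–Mills mass gap

CITATION HEADER.  T. Bałaban, *Regularity and decay of lattice Green's functions*, Commun. Math. Phys. **89** (1983)
571–597, doi:10.1007/bf01214744 [Balaban1983RegularityDecay] (cell paper B4; held text
`paper:balaban1983-cmp89-regularity-decay`, journal page = PDF page + 570; p. 589 [PDF 19] L26–L35 and p. 590 [PDF 20]
L1–L15 read by this seat on the text layer and on the ×2 renders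
`run/shared/lean/pub/pub-balaban/b2b-balaban-ref1/pages/1983-cmp89-regularity-decay/…-p019-x2.png`, `…-p020-x2.png`).
Unit `lit-balaban-r04` gen 11 (second reader of block B4; HOME `run/shared/lean/pub/lit-balaban/`), SKELETON row
**B4.Eq4.7** ((4.5)–(4.7), owner r01) — the lattice instance of r01 g4's `B4Ineq45Decoupling.ineq45`/`ineq46`, whose
docstring records «The lattice combinatorics of p. 589 (the `2d` matchings `B_{2μ−1}`, `B_{2μ}` of `Ω^{(k)} ⊂ ℤ^d` by the
parity of `x_μ`) is not needed for these statements and is not formalised here.»  Imports: `B4Ineq45Decoupling`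
(hence b04's `B4GaugeCovariance` dictionary `covOp`/`avgOp`/`green`/`fld`, p35's `B4Prop31Energy.keff` = `Δ^{(k)}(Ω,A)` of
(1.14), r01's cells `XC`/`YC`/`cR`/`WR`/`qR`/`TR`/`ψR`/`keffCell`, `ineq45`, `keff_form_nonneg`) and p35's
`B4Eq16GreenExists` (`covOp_posDef`: (1.6) is positive definite for every link field; `rBlkWt_cover`), `B4Prop31Holonomy`
(`transport_pmap`).

WHAT IS PRINTED (p. 589 L28–L35, p. 590 L7–L15 of the text layer; verbatim up to OCR).  «Now let us consider the set of
all positively oriented bonds ⟨x,x′⟩ ⊂ Ω^{(k)}. This set can be represented as a sum of 2d subsets B_i with the property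
that each point of Ω^{(k)} belongs to at most one bond in a given subset B_i. For example we can define B_{2μ−1} as a
set of bonds ⟨x, x + e_μ⟩ ⊂ Ω^{(k)} for which the coordinate x_μ of the point x is an odd number similarly we define
B_{2μ} with the difference that x_μ is an even number. For a given B_i there may be points which do not belong to any
bond of this set. Let us denote Δ(x,x′) = B^k(x) ∪ B^k(x′).» … (4.5) … «Each term in the second sum of the right side
(4.5) is non-negative, as it follows from the proof of (4.4), so we can omit these terms. Summing the inequalities (4.5)
over B_i, i = 1,…,2d, we get the inequality
  (the left hand side of (1.18)) ≥ (1/2d) Σ_{⟨x,x′⟩⊂Ω^{(k)}} [a_k|φ(x)|² + a_k|φ(x′)|² − a_k²⟨φ, Q_k(A)G_k(Δ(x,x′),A)Q_k^*(A)φ⟩].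
(4.6)  Now it is easily seen that to prove (1.18) it is sufficient to prove
  a_k|φ(x)|² + a_k|φ(x′)|² − a_k²⟨φ, Q_k(A)G_k(Δ(x,x′),A)Q_k^*(A)φ⟩ ≥ γ₀′|U(A(⟨x,x′⟩))φ(x′) − φ(x)|² − O(1)e²p²(e)(|φ(x)|²
  + |φ(x′)|²),   (4.7)
with γ₀′ independent of k, ⟨x,x′⟩, and A. Then γ₀ = ½ min{γ₀′/2d, a_k/(a_k + O(1))}.»  («the left hand side of (1.18)» =
`⟨φ, Δ^{(k)}(Ω,A)φ⟩` of (1.22) by the paper's global +4 cross-reference shift, CENSUS-r01; «a_k/(a_k+O(1))» is the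
constant of the mass part (4.4).)

WHAT THIS MODULE PROVES (all in full; the lattice is `ℤ^{d+1}` as everywhere in the tree's B4 files, so the printed
`2d` reads `2(d+1)`; `Ω` below is the finite set `Ω^{(k)}` of unit labels, the fine carrier `X` is ANY finite type
fibred over `Ω` by a block map `blk : X → Ω` compatible with the block weights `q` (`q(y,x) ≠ 0 ⇒ blk x = y`), the
bond weights `c`, link variables `W`, transporters `T`, `m²`, `a = a_k`, `s` are arbitrary — every link field).
* §1 `bonds Ω` (the positively oriented bonds `⟨x, x + e_μ⟩ ⊂ Ω`, indexed by lower end-point and direction), `cls`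
  (direction, parity of `x_μ`), `matching Ω i` = `B_i`; **`sum_bonds_eq_sum_matchings`** / `bonds_eq_biUnion` /
  `matching_disjoint` («this set can be represented as a sum of 2d subsets B_i»), **`eq_of_mem_matching_of_mem_ends`**
  («each point of Ω^{(k)} belongs to at most one bond in a given subset B_i»), `card_matchingIndex` (`= 2(d+1)`).
* §2 the cell structure of `B_i`: `lab Ω i : Ω → Ω` (a point is labelled by the lower end-point of its `B_i`-bond, else by
  itself), **`lab_eq_iff`** (the cell of a bond `b = ⟨x,x′⟩ ∈ B_i` is exactly `{x, x′}`, i.e. its fine sites are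
  `Δ(x,x′) = B^k(x) ∪ B^k(x′)`: `blk_lab_eq_iff`), compatibility with the blocks (`lab_blk_of_q`).
* §3 **`ineq46_printed`** — (4.6) AS PRINTED: `(2(d+1))⁻¹ · Σ_{b ∈ bonds Ω} bondTerm b φ ≤ ⟨φ, Δ^{(k)}(Ω,A)φ⟩`, where
  `bondTerm b φ` = `⟨φ|_{Δ(x,x′)}, Δ^{(k)}(Δ(x,x′),A) φ|_{Δ(x,x′)}⟩` = the printed bracket (r01's `keffCell` on the cell of
  `b`); from `ineq45` for each matching, `keff_form_nonneg` for the omitted singleton terms, and §1.  Hypotheses: those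
  of `ineq45` (`c ≥ 0`, `s ≥ 0`, the (1.8)-positivity `H_cell ≥ γ > 0` of the cell operators) and `m² ≥ 0`, `a ≥ 0`;
  **`ineq46_printed_of_mass_pos`** — the same with NO positivity hypothesis when `m² > 0` (`cell_form_ge_mass`: `γ = m²`).
* §4 **`lower_bound_of_ineq47`** — «to prove (1.18) it is sufficient to prove (4.7)»: if every bond term satisfies (4.7)
  with a constant `γ₀′` and an error `E·(|φ(x)|² + |φ(x′)|²)` (the right side's `|U(A(⟨x,x′⟩))φ(x′) − φ(x)|²` kept as an
  arbitrary bond functional `D b`), then `⟨φ, Δ^{(k)}φ⟩ ≥ (γ₀′/2(d+1))·Σ_b D b − E·|φ|²` (`sum_bonds_endSq_le`: a point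
  lies in at most `2(d+1)` bonds); **`prop31_of_ineq47_ineq44`** — with the mass part (4.4) `⟨φ, Δ^{(k)}φ⟩ ≥ κm²|φ|²`:
  `⟨φ, Δ^{(k)}φ⟩ ≥ γ₀(Σ_b D b + m²|φ|²) − (E/2)|φ|²`, `γ₀ = ½ min{γ₀′/2(d+1), κ}` — the printed «γ₀ = ½ min{γ₀′/2d,
  a_k/(a_k+O(1))}» (r01's scalar bookkeeping `B4.prop31_gamma0` on the actual forms).
* §5 **`cell_posDef`** — the cell operators `Δ`-data restricted to a cell are POSITIVE DEFINITE for every `m² ≥ 0`,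
  `a′ > 0` whenever the transporters are parallel transports along contours `Γ_{y,x}` through positively weighted bonds
  INSIDE the block `B^k(y)` (from a base site of the block to `x`), the links are orthogonal on weighted bonds and the
  block weights cover the sites (p35's `covOp_posDef` on the cell: a cell is a union of whole blocks, so the contours stay
  in it — `forall_mem_of_pathRel`, p35's `B4Prop31Holonomy.transport_pmap`); `exists_pos_mul_le_form_of_posDef` (a positive definite real
  matrix is `≥ γ·1`, `γ > 0`: minimum of the form on the unit sphere); **`ineq46_printed_of_contours`** — (4.6) with the
  cell positivity DISCHARGED under these structural hypotheses (one `γ` for the finitely many cells).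
* §6 **`ineq46_printed_region`** — (4.6) AS PRINTED ON [B4]'s LATTICE MODEL, HYPOTHESIS-FREE: the region carrier
  `fineDom n Ω` of r01's lineage (Neumann weights `regWt`, block weights `rBlkWt`, base corners `rbaseEmb`, staircase
  contours `rstairContour`, links `fieldLink F κ A`) for EVERY vector field `A`, orthogonal flow `F`, coupling `κ`,
  `n ≥ 1`, finite `Ω^{(k)} ⊂ ℤ^{d+1}`, `m² ≥ 0`, `a_k > 0`, `s > 0`, `φ`.
HONEST SCOPE.  Lattice combinatorics + the two printed bookkeeping steps; the analytic content of (4.7) ((4.8)–(4.22)) is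
elsewhere (`B4Ineq410GaugeOut`, `B4Ineq412ConstField`, `B4Ineq414TwoBlock`, `B4Eq48FirstOrder`, `B4Eq49TwoBlockGreen`, and
p35's `B4Prop31Regular` which proves (1.22) by a global route).  The (1.8)-positivity of the cell operators is a
HYPOTHESIS in `ineq46_printed` exactly as in `ineq45`, and is DISCHARGED in `ineq46_printed_of_mass_pos` (`m² > 0`,
`γ = m²`), in `ineq46_printed_of_contours` (every `m² ≥ 0`, block-internal contours) and on the model
(`ineq46_printed_region`); the constant `γ` is obtained by compactness, not computed.
Definitions with bodies (`bonds`, `cls`, `matching`, `ends`, `lab`, `bondTerm`, `sqAt`, `endSq`, `rblk`), no `Prop`-valued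
fact, no `sorry`; axioms standard.
-/

namespace Literature.MathematicalPhysics.QuantumFieldTheory.Balaban1983to89.B4Ineq46Lattice

open Matrix Finset
open Literature.MathematicalPhysics.QuantumFieldTheory.Balaban1983to89.B4GaugeCovariance
open Literature.MathematicalPhysics.QuantumFieldTheory.Balaban1983to89.B4Lower18Regular
  (e1 e1_apply_self e1_apply_ne dotProduct_self_nonneg' dotProduct_eq_sum_fld covOp_form)
open Literature.MathematicalPhysics.QuantumFieldTheory.Balaban1983to89.B4Prop31Energy
open Literature.MathematicalPhysics.QuantumFieldTheory.Balaban1983to89.B4Ineq45Decoupling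
open Literature.MathematicalPhysics.QuantumFieldTheory.Balaban1983to89.B4Lower18Regular (PathRel val_pathEnd_pmap
  pathRel_pmap_iff)
open Literature.MathematicalPhysics.QuantumFieldTheory.Balaban1983to89.B4Prop31Holonomy (transport_pmap)
open Literature.MathematicalPhysics.QuantumFieldTheory.Balaban1983to89.B4Lower18RegularRegion (covOp_congr pathRel_mono
  rBlkWt rbaseEmb rstairContour regWt regWt_nonneg rBlkWt_nonneg rBlkWt_ne_zero rstairContour_path rstairContour_end
  rbaseEmb_blk compField)
open Literature.MathematicalPhysics.QuantumFieldTheory.Balaban1983to89.B4Lower18 (fineDom mem_fineDom)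
open Literature.MathematicalPhysics.QuantumFieldTheory.Balaban1983to89.B4Reflection242 (blk)
open Literature.MathematicalPhysics.QuantumFieldTheory.Balaban1983to89.B4Eq16GreenExists (covOp_posDef rBlkWt_cover)

noncomputable section

variable {d : ℕ}

/-! ## §1. The positively oriented bonds of `Ω^{(k)}` and the `2d` parity matchings `B_i` -/

/-- **THE POSITIVELY ORIENTED BONDS `⟨x, x + e_μ⟩ ⊂ Ω^{(k)}`**, indexed by (lower end-point `x ∈ Ω`, direction `μ`)
with the upper end-point `x + e_μ` in `Ω`. [cite: Balaban1983RegularityDecay, p.589 «the set of all positively oriented bonds ⟨x,x′⟩ ⊂ Ω^{(k)}»] -/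
def bonds (Ω : Finset (Fin (d + 1) → ℤ)) : Finset (↥Ω × Fin (d + 1)) :=
  Finset.univ.filter fun b => b.1.1 + e1 b.2 ∈ Ω

/-- membership in the bond set. [cite: Balaban1983RegularityDecay, p.589 «positively oriented bonds ⟨x,x′⟩ ⊂ Ω^{(k)}»] -/
theorem mem_bonds {Ω : Finset (Fin (d + 1) → ℤ)} {b : ↥Ω × Fin (d + 1)} : b ∈ bonds Ω ↔ b.1.1 + e1 b.2 ∈ Ω := by
  simp [bonds]

/-- THE MATCHING INDEX of a bond `⟨x, x + e_μ⟩`: the direction `μ` and the parity of the coordinate `x_μ` (print's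
`B_{2μ−1}`: `x_μ` odd, `B_{2μ}`: `x_μ` even). [cite: Balaban1983RegularityDecay, p.589 «B_{2μ−1} … x_μ … is an odd number … B_{2μ} … x_μ is an even number»] -/
def cls {Ω : Finset (Fin (d + 1) → ℤ)} (b : ↥Ω × Fin (d + 1)) : Fin (d + 1) × Bool :=
  (b.2, decide (b.1.1 b.2 % 2 = 0))

/-- **THE SUBSET `B_i`** of the bonds of `Ω^{(k)}`, `i = (μ, parity)`. [cite: Balaban1983RegularityDecay, p.589 «2d subsets B_i»] -/
def matching (Ω : Finset (Fin (d + 1) → ℤ)) (j : Fin (d + 1) × Bool) : Finset (↥Ω × Fin (d + 1)) :=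
  (bonds Ω).filter fun b => cls b = j

/-- membership in `B_i`. [cite: Balaban1983RegularityDecay, p.589 «2d subsets B_i»] -/
theorem mem_matching {Ω : Finset (Fin (d + 1) → ℤ)} {j : Fin (d + 1) × Bool} {b : ↥Ω × Fin (d + 1)} :
    b ∈ matching Ω j ↔ b ∈ bonds Ω ∧ cls b = j := Finset.mem_filter

/-- **«This set can be represented as a sum of 2d subsets B_i»** — as a sum identity: a sum over all bonds of `Ω^{(k)}`
is the sum over the matchings of the sums over their bonds. [cite: Balaban1983RegularityDecay, p.589 «This set can be represented as a sum of 2d subsets B_i»] -/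
theorem sum_bonds_eq_sum_matchings {β : Type*} [AddCommMonoid β] (Ω : Finset (Fin (d + 1) → ℤ))
    (f : ↥Ω × Fin (d + 1) → β) : ∑ b ∈ bonds Ω, f b = ∑ j, ∑ b ∈ matching Ω j, f b := by
  unfold matching
  exact (Finset.sum_fiberwise_of_maps_to (s := bonds Ω) (t := Finset.univ) (g := cls) (f := f)
    fun b _ => Finset.mem_univ _).symm

/-- … as a set identity: the bond set is the union of the `B_i`. [cite: Balaban1983RegularityDecay, p.589 «This set can be represented as a sum of 2d subsets B_i»] -/
theorem bonds_eq_biUnion (Ω : Finset (Fin (d + 1) → ℤ)) : bonds Ω = Finset.univ.biUnion (matching Ω) := by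
  ext b
  simp only [Finset.mem_biUnion, Finset.mem_univ, true_and, mem_matching]
  exact ⟨fun h => ⟨cls b, h, rfl⟩, fun ⟨_, h, _⟩ => h⟩

/-- … and the `B_i` are pairwise disjoint. [cite: Balaban1983RegularityDecay, p.589 «This set can be represented as a sum of 2d subsets B_i»] -/
theorem matching_disjoint (Ω : Finset (Fin (d + 1) → ℤ)) {j j' : Fin (d + 1) × Bool} (hjj : j ≠ j') :
    Disjoint (matching Ω j) (matching Ω j') := by
  rw [Finset.disjoint_left]
  intro b hb hb'
  exact hjj ((mem_matching.1 hb).2.symm.trans (mem_matching.1 hb').2)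

/-- the two END-POINTS `x`, `x′ = x + e_μ` of a bond. [cite: Balaban1983RegularityDecay, p.589 «bonds ⟨x, x + e_μ⟩», dictionary] -/
def ends {Ω : Finset (Fin (d + 1) → ℤ)} (b : ↥Ω × Fin (d + 1)) : Finset (Fin (d + 1) → ℤ) :=
  {b.1.1, b.1.1 + e1 b.2}

/-- membership in the end-point set. [cite: Balaban1983RegularityDecay, p.589 «bonds ⟨x, x + e_μ⟩», dictionary] -/
theorem mem_ends {Ω : Finset (Fin (d + 1) → ℤ)} {b : ↥Ω × Fin (d + 1)} {y : Fin (d + 1) → ℤ} :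
    y ∈ ends b ↔ y = b.1.1 ∨ y = b.1.1 + e1 b.2 := by
  simp [ends]

/-- the `μ`-coordinate of the upper end-point is that of the lower one plus `1`. [cite: Balaban1983RegularityDecay, p.589 «bonds ⟨x, x + e_μ⟩», dictionary] -/
theorem add_e1_apply_self (y : Fin (d + 1) → ℤ) (μ : Fin (d + 1)) : (y + e1 μ) μ = y μ + 1 := by
  rw [Pi.add_apply, e1_apply_self]

/-- parity flips along a bond: `x_μ + 1` is even iff `x_μ` is odd. [cite: Balaban1983RegularityDecay, p.589 «x_μ … is an odd number … x_μ is an even number», dictionary] -/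
theorem decide_succ_mod_two (z : ℤ) : decide ((z + 1) % 2 = 0) = !decide (z % 2 = 0) := by
  by_cases h : z % 2 = 0
  · have h' : ¬ ((z + 1) % 2 = 0) := by omega
    rw [decide_eq_false h', decide_eq_true h]; rfl
  · have h' : (z + 1) % 2 = 0 := by omega
    rw [decide_eq_true h', decide_eq_false h]; rfl

/-- **«each point of Ω^{(k)} belongs to at most one bond in a given subset B_i»**: two bonds of the same `B_i` sharing an
end-point are equal. [cite: Balaban1983RegularityDecay, p.589 «each point of Ω^{(k)} belongs to at most one bond in a given subset B_i»] -/
theorem eq_of_mem_matching_of_mem_ends {Ω : Finset (Fin (d + 1) → ℤ)} {j : Fin (d + 1) × Bool}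
    {b₁ b₂ : ↥Ω × Fin (d + 1)} (h₁ : b₁ ∈ matching Ω j) (h₂ : b₂ ∈ matching Ω j) {y : Fin (d + 1) → ℤ}
    (hy₁ : y ∈ ends b₁) (hy₂ : y ∈ ends b₂) : b₁ = b₂ := by
  obtain ⟨⟨p, hp⟩, μ⟩ := b₁
  obtain ⟨⟨q, hq⟩, ν⟩ := b₂
  have hc₁ := (mem_matching.1 h₁).2
  have hc₂ := (mem_matching.1 h₂).2
  simp only [cls] at hc₁ hc₂
  have hμ : μ = j.1 := (Prod.ext_iff.1 hc₁).1
  have hν : ν = j.1 := (Prod.ext_iff.1 hc₂).1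
  have hνμ : ν = μ := hν.trans hμ.symm
  subst hνμ
  have hpar : decide (p ν % 2 = 0) = decide (q ν % 2 = 0) :=
    (Prod.ext_iff.1 hc₁).2.trans (Prod.ext_iff.1 hc₂).2.symm
  simp only [mem_ends] at hy₁ hy₂
  -- the four incidence cases
  have key : p = q := by
    rcases hy₁ with h1 | h1 <;> rcases hy₂ with h2 | h2
    · exact h1.symm.trans h2
    · -- `p = q + e_ν`: parities differ
      exfalso
      have hpq : p = q + e1 ν := h1.symm.trans h2
      have h3 : p ν = q ν + 1 := by rw [hpq, add_e1_apply_self]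
      rw [h3, decide_succ_mod_two] at hpar
      cases hq' : decide (q ν % 2 = 0) <;> rw [hq'] at hpar <;> exact Bool.noConfusion hpar
    · exfalso
      have hqp : q = p + e1 ν := h2.symm.trans h1
      have h3 : q ν = p ν + 1 := by rw [hqp, add_e1_apply_self]
      rw [h3, decide_succ_mod_two] at hpar
      cases hp' : decide (p ν % 2 = 0) <;> rw [hp'] at hpar <;> exact Bool.noConfusion hpar
    · exact add_right_cancel (h1.symm.trans h2)
  subst key
  rfl

/-- the number of matchings is `2d` (here `2(d+1)`, the lattice being `ℤ^{d+1}`). [cite: Balaban1983RegularityDecay, p.589 «2d subsets B_i», p.590 «i = 1,…,2d»] -/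
theorem card_matchingIndex : Fintype.card (Fin (d + 1) × Bool) = 2 * (d + 1) := by
  rw [Fintype.card_prod, Fintype.card_fin, Fintype.card_bool, mul_comm]

/-- a bond of `B_i` is determined by its lower end-point (its direction is that of `B_i`).
[cite: Balaban1983RegularityDecay, p.589 «each point of Ω^{(k)} belongs to at most one bond in a given subset B_i»] -/
theorem fst_injOn_matching (Ω : Finset (Fin (d + 1) → ℤ)) (j : Fin (d + 1) × Bool) :
    Set.InjOn (fun b : ↥Ω × Fin (d + 1) => b.1) (matching Ω j) := by
  intro b₁ h₁ b₂ h₂ heq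
  have hμ₁ : b₁.2 = j.1 := (Prod.ext_iff.1 (mem_matching.1 (Finset.mem_coe.1 h₁)).2).1
  have hμ₂ : b₂.2 = j.1 := (Prod.ext_iff.1 (mem_matching.1 (Finset.mem_coe.1 h₂)).2).1
  exact Prod.ext heq (hμ₁.trans hμ₂.symm)

/-! ## §2. The cell structure of a matching: `Δ(x,x′) = B^k(x) ∪ B^k(x′)` for the bonds of `B_i`, singletons else -/

/-- THE CELL LABEL of a point of `Ω^{(k)}` in the Neumann separation along `B_i`, `i = (μ, parity)`: a point whose `x_μ`
has the parity of `B_i` is labelled by itself (it is the lower end-point of its `B_i`-bond, or single); a point of the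
other parity is labelled by `x − e_μ` when that point lies in `Ω` (it is then the upper end-point of the `B_i`-bond
`⟨x − e_μ, x⟩`), else by itself. [cite: Balaban1983RegularityDecay, p.589 «Δ(x,x′) = B^k(x) ∪ B^k(x′) … separating subsets of Ω by the Neumann boundary conditions»] -/
def lab (Ω : Finset (Fin (d + 1) → ℤ)) (j : Fin (d + 1) × Bool) (y : ↥Ω) : ↥Ω :=
  if decide (y.1 j.1 % 2 = 0) = j.2 then y
  else if h : y.1 - e1 j.1 ∈ Ω then ⟨y.1 - e1 j.1, h⟩ else y

/-- **THE CELL OF A BOND `b = ⟨x, x′⟩ ∈ B_i` IS `{x, x′}`**: a point of `Ω^{(k)}` carries the label `x` iff it is `x` or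
`x′ = x + e_μ`. [cite: Balaban1983RegularityDecay, p.589 «Δ(x,x′) = B^k(x) ∪ B^k(x′)»] -/
theorem lab_eq_iff {Ω : Finset (Fin (d + 1) → ℤ)} {j : Fin (d + 1) × Bool} {b : ↥Ω × Fin (d + 1)}
    (hb : b ∈ matching Ω j) (y : ↥Ω) : lab Ω j y = b.1 ↔ (y = b.1 ∨ y.1 = b.1.1 + e1 b.2) := by
  obtain ⟨hbd, hcl⟩ := mem_matching.1 hb
  rw [mem_bonds] at hbd
  have hμ : b.2 = j.1 := (Prod.ext_iff.1 hcl).1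
  have hpar : decide (b.1.1 j.1 % 2 = 0) = j.2 := by rw [← hμ]; exact (Prod.ext_iff.1 hcl).2
  constructor
  · intro h
    unfold lab at h
    split_ifs at h with h1 h2
    · exact Or.inl h
    · right
      have h' : y.1 - e1 j.1 = b.1.1 := congrArg Subtype.val h
      rw [hμ, ← h']; abel
    · exact absurd (h ▸ hpar) h1
  · rintro (h | h)
    · subst h
      unfold lab; rw [if_pos hpar]
    · have hy : y.1 j.1 = b.1.1 j.1 + 1 := by rw [h, hμ, add_e1_apply_self]
      have h1 : ¬ (decide (y.1 j.1 % 2 = 0) = j.2) := by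
        rw [hy, decide_succ_mod_two, ← hpar]
        cases decide (b.1.1 j.1 % 2 = 0) <;> decide
      have h2 : y.1 - e1 j.1 ∈ Ω := by
        have : y.1 - e1 j.1 = b.1.1 := by rw [h, hμ]; abel
        rw [this]; exact b.1.2
      unfold lab; rw [if_neg h1, dif_pos h2]
      exact Subtype.ext (by show y.1 - e1 j.1 = b.1.1; rw [h, hμ]; abel)

/-- the fine sites of the cell of a bond `b = ⟨x,x′⟩ ∈ B_i` are `Δ(x,x′) = B^k(x) ∪ B^k(x′)`: a fine site (block map `blk`)
carries the label `x` iff its block is `B^k(x)` or `B^k(x′)`. [cite: Balaban1983RegularityDecay, p.589 «Δ(x,x′) = B^k(x) ∪ B^k(x′)»] -/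
theorem blk_lab_eq_iff {X : Type*} {Ω : Finset (Fin (d + 1) → ℤ)} (blk : X → ↥Ω) {j : Fin (d + 1) × Bool}
    {b : ↥Ω × Fin (d + 1)} (hb : b ∈ matching Ω j) (x : X) :
    (lab Ω j ∘ blk) x = b.1 ↔ (blk x = b.1 ∨ (blk x).1 = b.1.1 + e1 b.2) :=
  lab_eq_iff hb (blk x)

/-- compatibility of the cells with the blocks: `q(y,x) ≠ 0 ⇒` the fine site `x` and the unit site `y` lie in the same
cell (the hypothesis `hq` of `B4Ineq45Decoupling.ineq45`). [cite: Balaban1983RegularityDecay, p.589 «separating subsets of Ω by the Neumann boundary conditions», dictionary] -/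
theorem lab_blk_of_q {X : Type*} {Ω : Finset (Fin (d + 1) → ℤ)} (blk : X → ↥Ω) {q : ↥Ω → X → ℝ}
    (hq : ∀ y x, q y x ≠ 0 → blk x = y) (j : Fin (d + 1) × Bool) :
    ∀ y x, q y x ≠ 0 → (lab Ω j ∘ blk) x = lab Ω j y := by
  intro y x h
  rw [Function.comp_apply, hq y x h]

/-! ## §3. (4.6) as printed -/

section Ineq46

variable {X ι : Type*} [Fintype X] [Fintype ι] [DecidableEq X] [DecidableEq ι]

/-- **THE PRINTED BOND TERM `a_k|φ(x)|² + a_k|φ(x′)|² − a_k²⟨φ, Q_k(A)G_k(Δ(x,x′),A)Q_k^*(A)φ⟩`** of the bond `b = ⟨x,x′⟩`: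
the form of `Δ^{(k)}(Δ(x,x′),A)` (r01's `keffCell` = the construction (1.14) on the cell `Δ(x,x′) = B^k(x) ∪ B^k(x′)` of the
matching containing `b`, Neumann conditions) at `φ|_{Δ(x,x′)}`. [cite: Balaban1983RegularityDecay, (4.5)–(4.6) p.590] -/
def bondTerm (Ω : Finset (Fin (d + 1) → ℤ)) (blk : X → ↥Ω) (c : X → X → ℝ) (m2 a s : ℝ) (q : ↥Ω → X → ℝ)
    (W : X → X → Matrix ι ι ℝ) (T : ↥Ω → X → Matrix ι ι ℝ) (b : ↥Ω × Fin (d + 1)) (ψ : ↥Ω × ι → ℝ) : ℝ :=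
  ψR (lab Ω (cls b)) b.1 ψ ⬝ᵥ
    (keffCell (lab Ω (cls b) ∘ blk) (lab Ω (cls b)) c m2 a s q W T b.1 *ᵥ ψR (lab Ω (cls b)) b.1 ψ)

/-- on a bond of `B_i` the bond term is the `B_i`-cell term of its lower end-point. [cite: Balaban1983RegularityDecay, (4.5)–(4.6) p.590] -/
theorem bondTerm_eq_of_mem (Ω : Finset (Fin (d + 1) → ℤ)) (blk : X → ↥Ω) (c : X → X → ℝ) (m2 a s : ℝ)
    (q : ↥Ω → X → ℝ) (W : X → X → Matrix ι ι ℝ) (T : ↥Ω → X → Matrix ι ι ℝ) {j : Fin (d + 1) × Bool}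
    {b : ↥Ω × Fin (d + 1)} (hb : b ∈ matching Ω j) (ψ : ↥Ω × ι → ℝ) :
    bondTerm Ω blk c m2 a s q W T b ψ = ψR (lab Ω j) b.1 ψ ⬝ᵥ
      (keffCell (lab Ω j ∘ blk) (lab Ω j) c m2 a s q W T b.1 *ᵥ ψR (lab Ω j) b.1 ψ) := by
  obtain ⟨_, hcl⟩ := mem_matching.1 hb
  subst hcl
  rfl

/-- **(4.6) AS PRINTED** — «Summing the inequalities (4.5) over B_i, i = 1,…,2d, we get the inequality (the left hand
side of (1.18)) ≥ (1/2d) Σ_{⟨x,x′⟩⊂Ω^{(k)}} [a_k|φ(x)|² + a_k|φ(x′)|² − a_k²⟨φ, Q_k(A)G_k(Δ(x,x′),A)Q_k^*(A)φ⟩]»: for EVERY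
finite `Ω^{(k)} ⊂ ℤ^{d+1}`, every fine carrier fibred over its blocks, every bond weights `c ≥ 0`, link variables `W`,
transporters `T`, `m² ≥ 0`, `a_k ≥ 0`, `s ≥ 0`, under the (1.8)-positivity of the cell operators (as in `ineq45`):
`(2(d+1))⁻¹ · Σ_{b ∈ bonds Ω} bondTerm b φ ≤ ⟨φ, Δ^{(k)}(Ω,A)φ⟩`.  Proof as printed: (4.5) (`ineq45`) for the cell
structure of each `B_i`, the singleton (and empty) cell terms are `≥ 0` (`keff_form_nonneg`) and omitted, the bond cells
of `B_i` are its bonds (`lab_eq_iff`, one cell per bond: `fst_injOn_matching`), and the `2(d+1)` inequalities are summed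
(`sum_bonds_eq_sum_matchings`). [cite: Balaban1983RegularityDecay, (4.6) p.590] -/
theorem ineq46_printed (Ω : Finset (Fin (d + 1) → ℤ)) (blk : X → ↥Ω) {c : X → X → ℝ} (hc : ∀ x x', 0 ≤ c x x')
    {m2 a s : ℝ} (hm : 0 ≤ m2) (ha : 0 ≤ a) (hs : 0 ≤ s) {q : ↥Ω → X → ℝ} (hq : ∀ y x, q y x ≠ 0 → blk x = y)
    (W : X → X → Matrix ι ι ℝ) (T : ↥Ω → X → Matrix ι ι ℝ) {γ : ℝ} (hγ : 0 < γ)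
    (hH : ∀ (j : Fin (d + 1) × Bool) (i : ↥Ω) (v : XC (lab Ω j ∘ blk) i × ι → ℝ), γ * (v ⬝ᵥ v) ≤
      v ⬝ᵥ (covOp (cR (lab Ω j ∘ blk) c i) m2 (a * s) (qR (lab Ω j ∘ blk) (lab Ω j) q i)
        (WR (lab Ω j ∘ blk) W i) (TR (lab Ω j ∘ blk) (lab Ω j) T i) *ᵥ v))
    (ψ : ↥Ω × ι → ℝ) :
    (2 * ((d : ℝ) + 1))⁻¹ * ∑ b ∈ bonds Ω, bondTerm Ω blk c m2 a s q W T b ψ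
      ≤ ψ ⬝ᵥ (keff c m2 a s q W T *ᵥ ψ) := by
  classical
  -- (4.5) for the matching `j`, singleton terms dropped
  have hj : ∀ j : Fin (d + 1) × Bool,
      ∑ b ∈ matching Ω j, bondTerm Ω blk c m2 a s q W T b ψ ≤ ψ ⬝ᵥ (keff c m2 a s q W T *ᵥ ψ) := by
    intro j
    set F : ↥Ω → ℝ := fun i => ψR (lab Ω j) i ψ ⬝ᵥ
      (keffCell (lab Ω j ∘ blk) (lab Ω j) c m2 a s q W T i *ᵥ ψR (lab Ω j) i ψ) with hF
    have h45 : ∑ i, F i ≤ ψ ⬝ᵥ (keff c m2 a s q W T *ᵥ ψ) :=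
      ineq45 (lab Ω j ∘ blk) (lab Ω j) hc m2 a hs (lab_blk_of_q blk hq j) W T hγ (hH j) ψ
    have hF0 : ∀ i, 0 ≤ F i := fun i =>
      keff_form_nonneg (c := cR (lab Ω j ∘ blk) c i) (fun x x' => hc _ _) hm ha hs _ _ _ hγ (hH j i) _
    have h1 : ∑ b ∈ matching Ω j, bondTerm Ω blk c m2 a s q W T b ψ = ∑ b ∈ matching Ω j, F b.1 :=
      Finset.sum_congr rfl fun b hb => bondTerm_eq_of_mem Ω blk c m2 a s q W T hb ψ
    have h2 : ∑ b ∈ matching Ω j, F b.1 = ∑ i ∈ (matching Ω j).image (fun b => b.1), F i :=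
      (Finset.sum_image (fst_injOn_matching Ω j)).symm
    have h3 : ∑ i ∈ (matching Ω j).image (fun b => b.1), F i ≤ ∑ i, F i :=
      Finset.sum_le_sum_of_subset_of_nonneg (Finset.subset_univ _) fun i _ _ => hF0 i
    linarith
  rw [sum_bonds_eq_sum_matchings]
  have htot := Finset.sum_le_sum fun j (_ : j ∈ (Finset.univ : Finset (Fin (d + 1) × Bool))) => hj j
  rw [Finset.sum_const, Finset.card_univ, card_matchingIndex, nsmul_eq_mul] at htot
  push_cast at htot
  have hpos : (0 : ℝ) < 2 * ((d : ℝ) + 1) := by positivity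
  rw [inv_mul_le_iff₀ hpos]
  linarith

/-- the (1.8)-positivity hypothesis of `ineq45`/`ineq46_printed` holds with `γ = m²` for EVERY cell structure and every
data with `c ≥ 0`, `a·s ≥ 0` when `m² > 0` (the kinetic and block terms of (1.6) are non-negative).
[cite: Balaban1983RegularityDecay, (1.6) p.572, (1.8) p.573] -/
theorem cell_form_ge_mass {C : Type*} [DecidableEq C] {Y : Type*} [Fintype Y] (cellX : X → C) (cellY : Y → C)
    {c : X → X → ℝ} (hc : ∀ x x', 0 ≤ c x x') (m2 : ℝ) {a' : ℝ} (ha' : 0 ≤ a') (q : Y → X → ℝ)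
    (W : X → X → Matrix ι ι ℝ) (T : Y → X → Matrix ι ι ℝ) (i : C) (v : XC cellX i × ι → ℝ) :
    m2 * (v ⬝ᵥ v) ≤ v ⬝ᵥ (covOp (cR cellX c i) m2 a' (qR cellX cellY q i) (WR cellX W i) (TR cellX cellY T i) *ᵥ v) := by
  rw [covOp_form, projOp_form]
  have h1 := covLap_form_nonneg (c := cR cellX c i) (fun x x' => hc _ _) (WR cellX W i) v
  have h2 := dotProduct_self_nonneg' (avgOp (qR cellX cellY q i) (TR cellX cellY T i) *ᵥ v)
  nlinarith [mul_nonneg ha' h2]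

/-- **(4.6) AS PRINTED, HYPOTHESIS-FREE IN THE MASSIVE CASE `m² > 0`**: for every finite `Ω^{(k)} ⊂ ℤ^{d+1}`, every fine
carrier fibred over its blocks, every `c ≥ 0`, `W`, `T`, `a_k ≥ 0`, `s ≥ 0`:
`(2(d+1))⁻¹ · Σ_{b ∈ bonds Ω} bondTerm b φ ≤ ⟨φ, Δ^{(k)}(Ω,A)φ⟩` (the cell positivity with `γ = m²`, `cell_form_ge_mass`).
[cite: Balaban1983RegularityDecay, (4.6) p.590] -/
theorem ineq46_printed_of_mass_pos (Ω : Finset (Fin (d + 1) → ℤ)) (blk : X → ↥Ω) {c : X → X → ℝ}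
    (hc : ∀ x x', 0 ≤ c x x') {m2 a s : ℝ} (hm : 0 < m2) (ha : 0 ≤ a) (hs : 0 ≤ s) {q : ↥Ω → X → ℝ}
    (hq : ∀ y x, q y x ≠ 0 → blk x = y) (W : X → X → Matrix ι ι ℝ) (T : ↥Ω → X → Matrix ι ι ℝ)
    (ψ : ↥Ω × ι → ℝ) :
    (2 * ((d : ℝ) + 1))⁻¹ * ∑ b ∈ bonds Ω, bondTerm Ω blk c m2 a s q W T b ψ
      ≤ ψ ⬝ᵥ (keff c m2 a s q W T *ᵥ ψ) :=
  ineq46_printed Ω blk hc hm.le ha hs hq W T hm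
    (fun j i v => cell_form_ge_mass (lab Ω j ∘ blk) (lab Ω j) hc m2 (mul_nonneg ha hs) q W T i v) ψ

end Ineq46

/-! ## §4. «To prove (1.18) it is sufficient to prove (4.7)»; «γ₀ = ½ min{γ₀′/2d, a_k/(a_k + O(1))}» -/

section Reduction

variable {X ι : Type*} [Fintype X] [Fintype ι] [DecidableEq X] [DecidableEq ι]

/-- `|φ(z)|²` at a lattice point, `0` off `Ω^{(k)}`. [cite: Balaban1983RegularityDecay, (4.7) p.590 «|φ(x)|² + |φ(x′)|²», dictionary] -/
def sqAt (Ω : Finset (Fin (d + 1) → ℤ)) (ψ : ↥Ω × ι → ℝ) (z : Fin (d + 1) → ℤ) : ℝ :=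
  if h : z ∈ Ω then fld ψ ⟨z, h⟩ ⬝ᵥ fld ψ ⟨z, h⟩ else 0

omit [Fintype X] [DecidableEq X] [DecidableEq ι] in
/-- `sqAt` at a point of `Ω`. [cite: Balaban1983RegularityDecay, (4.7) p.590, dictionary] -/
theorem sqAt_of_mem (Ω : Finset (Fin (d + 1) → ℤ)) (ψ : ↥Ω × ι → ℝ) (y : ↥Ω) :
    sqAt Ω ψ y.1 = fld ψ y ⬝ᵥ fld ψ y := by
  unfold sqAt; rw [dif_pos y.2]

omit [Fintype X] [DecidableEq X] [DecidableEq ι] in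
/-- `sqAt ≥ 0`. [cite: Balaban1983RegularityDecay, (4.7) p.590, dictionary] -/
theorem sqAt_nonneg (Ω : Finset (Fin (d + 1) → ℤ)) (ψ : ↥Ω × ι → ℝ) (z : Fin (d + 1) → ℤ) : 0 ≤ sqAt Ω ψ z := by
  unfold sqAt; split_ifs
  · exact dotProduct_self_nonneg' _
  · exact le_rfl

/-- the error weight `|φ(x)|² + |φ(x′)|²` of (4.7) at the bond `⟨x,x′⟩`. [cite: Balaban1983RegularityDecay, (4.7) p.590 «(|φ(x)|² + |φ(x′)|²)»] -/
def endSq (Ω : Finset (Fin (d + 1) → ℤ)) (ψ : ↥Ω × ι → ℝ) (b : ↥Ω × Fin (d + 1)) : ℝ :=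
  fld ψ b.1 ⬝ᵥ fld ψ b.1 + sqAt Ω ψ (b.1.1 + e1 b.2)

omit [Fintype X] [DecidableEq X] [DecidableEq ι] in
/-- **a point lies in at most `2d` bonds**: `Σ_{⟨x,x′⟩⊂Ω^{(k)}} (|φ(x)|² + |φ(x′)|²) ≤ 2(d+1)·|φ|²` (each point is the lower
end-point of at most `d+1` bonds and the upper end-point of at most `d+1`). [cite: Balaban1983RegularityDecay, p.590 «γ₀ = ½ min{γ₀′/2d, …}», dictionary] -/
theorem sum_bonds_endSq_le (Ω : Finset (Fin (d + 1) → ℤ)) (ψ : ↥Ω × ι → ℝ) :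
    ∑ b ∈ bonds Ω, endSq Ω ψ b ≤ 2 * ((d : ℝ) + 1) * (ψ ⬝ᵥ ψ) := by
  classical
  simp only [endSq]
  rw [Finset.sum_add_distrib]
  have hψ : ψ ⬝ᵥ ψ = ∑ y : ↥Ω, fld ψ y ⬝ᵥ fld ψ y := dotProduct_eq_sum_fld ψ ψ
  have hnn : ∀ y : ↥Ω, 0 ≤ fld ψ y ⬝ᵥ fld ψ y := fun y => dotProduct_self_nonneg' _
  -- lower end-points: `bonds Ω ⊆ Ω × directions`
  have hlow : ∑ b ∈ bonds Ω, fld ψ b.1 ⬝ᵥ fld ψ b.1 ≤ ((d : ℝ) + 1) * (ψ ⬝ᵥ ψ) := by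
    calc ∑ b ∈ bonds Ω, fld ψ b.1 ⬝ᵥ fld ψ b.1
        ≤ ∑ b : ↥Ω × Fin (d + 1), fld ψ b.1 ⬝ᵥ fld ψ b.1 :=
          Finset.sum_le_sum_of_subset_of_nonneg (Finset.subset_univ _) fun b _ _ => hnn b.1
      _ = ((d : ℝ) + 1) * (ψ ⬝ᵥ ψ) := by
          rw [Fintype.sum_prod_type, hψ, Finset.mul_sum]
          refine Finset.sum_congr rfl fun y _ => ?_
          dsimp only
          rw [Finset.sum_const, Finset.card_univ, Fintype.card_fin, nsmul_eq_mul]; push_cast; ring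
  -- upper end-points: `b ↦ (x + e_μ, μ)` is injective on the bonds
  have hup : ∑ b ∈ bonds Ω, sqAt Ω ψ (b.1.1 + e1 b.2) ≤ ((d : ℝ) + 1) * (ψ ⬝ᵥ ψ) := by
    set up : ↥Ω × Fin (d + 1) → (Fin (d + 1) → ℤ) × Fin (d + 1) := fun b => (b.1.1 + e1 b.2, b.2) with hup
    have hinj : Set.InjOn up (bonds Ω) := by
      intro b₁ _ b₂ _ h
      simp only [hup, Prod.mk.injEq] at h
      obtain ⟨h1, h2⟩ := h
      refine Prod.ext (Subtype.ext ?_) h2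
      rw [h2] at h1; exact add_right_cancel h1
    have himg : (bonds Ω).image up ⊆ (Ω ×ˢ (Finset.univ : Finset (Fin (d + 1)))) := by
      intro p hp
      obtain ⟨b, hb, rfl⟩ := Finset.mem_image.1 hp
      exact Finset.mem_product.2 ⟨mem_bonds.1 hb, Finset.mem_univ _⟩
    calc ∑ b ∈ bonds Ω, sqAt Ω ψ (b.1.1 + e1 b.2)
        = ∑ b ∈ bonds Ω, sqAt Ω ψ (up b).1 := rfl
      _ = ∑ p ∈ (bonds Ω).image up, sqAt Ω ψ p.1 := (Finset.sum_image (f := fun p => sqAt Ω ψ p.1) hinj).symm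
      _ ≤ ∑ p ∈ Ω ×ˢ (Finset.univ : Finset (Fin (d + 1))), sqAt Ω ψ p.1 :=
          Finset.sum_le_sum_of_subset_of_nonneg himg fun p _ _ => sqAt_nonneg Ω ψ _
      _ = ((d : ℝ) + 1) * (ψ ⬝ᵥ ψ) := by
          rw [Finset.sum_product, hψ, Finset.mul_sum, ← Finset.sum_attach Ω]
          refine Finset.sum_congr rfl fun y _ => ?_
          dsimp only
          rw [Finset.sum_const, Finset.card_univ, Fintype.card_fin, nsmul_eq_mul, sqAt_of_mem]
          push_cast; ring
  linarith

/-- **«Now it is easily seen that to prove (1.18) it is sufficient to prove (4.7) with γ₀′ independent of k, ⟨x,x′⟩, and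
A»**: if every bond term satisfies (4.7), `bondTerm b φ ≥ γ₀′·D(b) − E·(|φ(x)|² + |φ(x′)|²)` (`D(b)` standing for the
printed `|U(A(⟨x,x′⟩))φ(x′) − φ(x)|²`, `E` for `O(1)e²p²(e)`), then by (4.6)
`⟨φ, Δ^{(k)}(Ω,A)φ⟩ ≥ (γ₀′/2(d+1))·Σ_{⟨x,x′⟩⊂Ω^{(k)}} D(⟨x,x′⟩) − E·Σ_{x∈Ω^{(k)}}|φ(x)|²`. [cite: Balaban1983RegularityDecay, (4.6)–(4.7) p.590] -/
theorem lower_bound_of_ineq47 (Ω : Finset (Fin (d + 1) → ℤ)) (blk : X → ↥Ω) {c : X → X → ℝ}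
    (hc : ∀ x x', 0 ≤ c x x') {m2 a s : ℝ} (hm : 0 ≤ m2) (ha : 0 ≤ a) (hs : 0 ≤ s) {q : ↥Ω → X → ℝ}
    (hq : ∀ y x, q y x ≠ 0 → blk x = y) (W : X → X → Matrix ι ι ℝ) (T : ↥Ω → X → Matrix ι ι ℝ) {γ : ℝ} (hγ : 0 < γ)
    (hH : ∀ (j : Fin (d + 1) × Bool) (i : ↥Ω) (v : XC (lab Ω j ∘ blk) i × ι → ℝ), γ * (v ⬝ᵥ v) ≤
      v ⬝ᵥ (covOp (cR (lab Ω j ∘ blk) c i) m2 (a * s) (qR (lab Ω j ∘ blk) (lab Ω j) q i)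
        (WR (lab Ω j ∘ blk) W i) (TR (lab Ω j ∘ blk) (lab Ω j) T i) *ᵥ v))
    (ψ : ↥Ω × ι → ℝ) (D : ↥Ω × Fin (d + 1) → ℝ) {γ' E : ℝ} (hE : 0 ≤ E)
    (h47 : ∀ b ∈ bonds Ω, γ' * D b - E * endSq Ω ψ b ≤ bondTerm Ω blk c m2 a s q W T b ψ) :
    γ' / (2 * ((d : ℝ) + 1)) * ∑ b ∈ bonds Ω, D b - E * (ψ ⬝ᵥ ψ) ≤ ψ ⬝ᵥ (keff c m2 a s q W T *ᵥ ψ) := by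
  have h46 := ineq46_printed Ω blk hc hm ha hs hq W T hγ hH ψ
  have hsum : γ' * ∑ b ∈ bonds Ω, D b - E * ∑ b ∈ bonds Ω, endSq Ω ψ b
      ≤ ∑ b ∈ bonds Ω, bondTerm Ω blk c m2 a s q W T b ψ := by
    rw [Finset.mul_sum, Finset.mul_sum, ← Finset.sum_sub_distrib]
    exact Finset.sum_le_sum h47
  have hend := sum_bonds_endSq_le Ω ψ
  have hpos : (0 : ℝ) < 2 * ((d : ℝ) + 1) := by positivity
  have hE' : E * ∑ b ∈ bonds Ω, endSq Ω ψ b ≤ E * (2 * ((d : ℝ) + 1) * (ψ ⬝ᵥ ψ)) :=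
    mul_le_mul_of_nonneg_left hend hE
  -- divide `hsum` by `2(d+1)`
  have h2 : γ' * ∑ b ∈ bonds Ω, D b - E * (2 * ((d : ℝ) + 1) * (ψ ⬝ᵥ ψ))
      ≤ ∑ b ∈ bonds Ω, bondTerm Ω blk c m2 a s q W T b ψ := by linarith
  have h3 := mul_le_mul_of_nonneg_left h2 (le_of_lt (inv_pos.2 hpos))
  have h4 : (2 * ((d : ℝ) + 1))⁻¹ * (γ' * ∑ b ∈ bonds Ω, D b - E * (2 * ((d : ℝ) + 1) * (ψ ⬝ᵥ ψ)))
      = γ' / (2 * ((d : ℝ) + 1)) * ∑ b ∈ bonds Ω, D b - E * (ψ ⬝ᵥ ψ) := by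
    have hcan : (2 * ((d : ℝ) + 1))⁻¹ * (2 * ((d : ℝ) + 1)) = 1 := inv_mul_cancel₀ hpos.ne'
    rw [div_eq_mul_inv]
    linear_combination (-(E * (ψ ⬝ᵥ ψ))) * hcan
  rw [h4] at h3
  exact h3.trans h46

/-- **«Then γ₀ = ½ min{γ₀′/2d, a_k/(a_k + O(1))}»**: combining the previous bound with the mass part (4.4)
`⟨φ, Δ^{(k)}φ⟩ ≥ κ·m²|φ|²` (`κ` = the printed `a_k/(a_k+O(1))`) by averaging the two inequalities:
`⟨φ, Δ^{(k)}(Ω,A)φ⟩ ≥ γ₀(Σ_{⟨x,x′⟩} D(⟨x,x′⟩) + m²|φ|²) − (E/2)|φ|²`, `γ₀ = ½ min{γ₀′/2(d+1), κ}` — the shape of (1.18)/(1.22).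
[cite: Balaban1983RegularityDecay, p.590 «Then γ₀ = ½ min{γ₀′/2d, a_k/(a_k+O(1))}», (4.4) p.589] -/
theorem prop31_of_ineq47_ineq44 (Ω : Finset (Fin (d + 1) → ℤ)) (blk : X → ↥Ω) {c : X → X → ℝ}
    (hc : ∀ x x', 0 ≤ c x x') {m2 a s : ℝ} (hm : 0 ≤ m2) (ha : 0 ≤ a) (hs : 0 ≤ s) {q : ↥Ω → X → ℝ}
    (hq : ∀ y x, q y x ≠ 0 → blk x = y) (W : X → X → Matrix ι ι ℝ) (T : ↥Ω → X → Matrix ι ι ℝ) {γ : ℝ} (hγ : 0 < γ)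
    (hH : ∀ (j : Fin (d + 1) × Bool) (i : ↥Ω) (v : XC (lab Ω j ∘ blk) i × ι → ℝ), γ * (v ⬝ᵥ v) ≤
      v ⬝ᵥ (covOp (cR (lab Ω j ∘ blk) c i) m2 (a * s) (qR (lab Ω j ∘ blk) (lab Ω j) q i)
        (WR (lab Ω j ∘ blk) W i) (TR (lab Ω j ∘ blk) (lab Ω j) T i) *ᵥ v))
    (ψ : ↥Ω × ι → ℝ) (D : ↥Ω × Fin (d + 1) → ℝ) (hD : ∀ b ∈ bonds Ω, 0 ≤ D b) {γ' E κ : ℝ} (hE : 0 ≤ E)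
    (h47 : ∀ b ∈ bonds Ω, γ' * D b - E * endSq Ω ψ b ≤ bondTerm Ω blk c m2 a s q W T b ψ)
    (h44 : κ * (m2 * (ψ ⬝ᵥ ψ)) ≤ ψ ⬝ᵥ (keff c m2 a s q W T *ᵥ ψ)) :
    (min (γ' / (2 * ((d : ℝ) + 1))) κ) / 2 * (∑ b ∈ bonds Ω, D b + m2 * (ψ ⬝ᵥ ψ)) - E / 2 * (ψ ⬝ᵥ ψ)
      ≤ ψ ⬝ᵥ (keff c m2 a s q W T *ᵥ ψ) := by
  have h1 := lower_bound_of_ineq47 Ω blk hc hm ha hs hq W T hγ hH ψ D hE h47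
  set γ₀' := γ' / (2 * ((d : ℝ) + 1)) with hγ₀'
  set R := ψ ⬝ᵥ (keff c m2 a s q W T *ᵥ ψ)
  set S := ∑ b ∈ bonds Ω, D b
  set N := ψ ⬝ᵥ ψ
  have hS : 0 ≤ S := Finset.sum_nonneg hD
  have hN : 0 ≤ N := dotProduct_self_nonneg' ψ
  have hmN : 0 ≤ m2 * N := mul_nonneg hm hN
  have hminS : min γ₀' κ * S ≤ γ₀' * S := mul_le_mul_of_nonneg_right (min_le_left _ _) hS
  have hminM : min γ₀' κ * (m2 * N) ≤ κ * (m2 * N) := mul_le_mul_of_nonneg_right (min_le_right _ _) hmN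
  -- average of `h1` and `h44`
  nlinarith [h1, h44, hminS, hminM]

end Reduction

/-! ## §5. The (1.8)-positivity of the cell operators from block-internal contours (every `m² ≥ 0`) -/

section CellPositivity

variable {X ι : Type*} [Fintype X] [Fintype ι] [DecidableEq X] [DecidableEq ι]

omit [Fintype X] [Fintype ι] [DecidableEq X] [DecidableEq ι] in
/-- a contour whose steps end in sites with property `P` has all its sites in `P`. [cite: Balaban1983RegularityDecay, (1.4) p.572 «contours in B^k(y)», dictionary] -/
theorem forall_mem_of_pathRel {r : X → X → Prop} {P : X → Prop} :
    ∀ (x : X) (l : List X), PathRel (fun u v => r u v ∧ P v) x l → ∀ u ∈ l, P u := by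
  intro x l
  induction l generalizing x with
  | nil => intro _ u hu; simp at hu
  | cons y l ih =>
      rintro ⟨⟨_, hy⟩, hl⟩ u hu
      rcases List.mem_cons.1 hu with rfl | hu
      · exact hy
      · exact ih y hl u hu

/-- **A POSITIVE DEFINITE MATRIX IS BOUNDED BELOW BY A POSITIVE MULTIPLE OF THE IDENTITY** (finite dimension:
the form attains its minimum on the unit sphere). [cite: Balaban1983RegularityDecay, (1.8) p.573 «a strictly positive lower bound», dictionary] -/
theorem exists_pos_mul_le_form_of_posDef {m : Type*} [Fintype m] [DecidableEq m] {M : Matrix m m ℝ} (hM : M.PosDef) :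
    ∃ γ : ℝ, 0 < γ ∧ ∀ v : m → ℝ, γ * (v ⬝ᵥ v) ≤ v ⬝ᵥ (M *ᵥ v) := by
  classical
  set K : Set (m → ℝ) := {v | v ⬝ᵥ v = 1} with hK
  have hcontf : Continuous fun v : m → ℝ => v ⬝ᵥ (M *ᵥ v) :=
    Continuous.dotProduct continuous_id ((Matrix.mulVecLin M).continuous_of_finiteDimensional.comp continuous_id)
  have hKc : IsCompact K := by
    refine Metric.isCompact_of_isClosed_isBounded (isClosed_eq (Continuous.dotProduct continuous_id continuous_id)
      continuous_const) ?_
    refine (Metric.isBounded_iff_subset_closedBall (0 : m → ℝ)).2 ⟨1, fun v hv => ?_⟩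
    rw [mem_closedBall_zero_iff, pi_norm_le_iff_of_nonneg zero_le_one]
    intro i
    have hvi : v i * v i ≤ v ⬝ᵥ v := by
      rw [dotProduct]
      exact Finset.single_le_sum (f := fun j => v j * v j) (fun j _ => mul_self_nonneg (v j)) (Finset.mem_univ i)
    rw [Real.norm_eq_abs]
    have hK1 : v ⬝ᵥ v = 1 := hv
    nlinarith [abs_mul_abs_self (v i), abs_nonneg (v i)]
  by_cases hKe : K.Nonempty
  · obtain ⟨v₀, hv₀, hmin⟩ := hKc.exists_isMinOn hKe hcontf.continuousOn
    have hv₀1 : v₀ ⬝ᵥ v₀ = 1 := hv₀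
    have hv₀ne : v₀ ≠ 0 := by
      intro h; rw [h, dotProduct_zero] at hv₀1; exact zero_ne_one hv₀1
    refine ⟨v₀ ⬝ᵥ (M *ᵥ v₀), ?_, fun v => ?_⟩
    · have := hM.dotProduct_mulVec_pos hv₀ne
      simpa only [star_trivial] using this
    · by_cases hv : v ⬝ᵥ v = 0
      · have hv0 : v = 0 := dotProduct_self_eq_zero.1 hv
        rw [hv0, dotProduct_zero, Matrix.mulVec_zero, dotProduct_zero, mul_zero]
      · have hpos : 0 < v ⬝ᵥ v := lt_of_le_of_ne (dotProduct_self_nonneg' v) (Ne.symm hv)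
        set r := Real.sqrt (v ⬝ᵥ v) with hr
        have hr0 : 0 < r := Real.sqrt_pos.2 hpos
        have hrr : r * r = v ⬝ᵥ v := Real.mul_self_sqrt hpos.le
        set u := r⁻¹ • v with hu
        have huK : u ∈ K := by
          show u ⬝ᵥ u = 1
          rw [hu, smul_dotProduct, dotProduct_smul, smul_eq_mul, smul_eq_mul, ← hrr]
          field_simp
        have hle : v₀ ⬝ᵥ (M *ᵥ v₀) ≤ u ⬝ᵥ (M *ᵥ u) := hmin huK
        -- `u ⬝ (M u) = r⁻² · v ⬝ (M v)`
        have hscale : u ⬝ᵥ (M *ᵥ u) = r⁻¹ * r⁻¹ * (v ⬝ᵥ (M *ᵥ v)) := by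
          rw [hu, Matrix.mulVec_smul, smul_dotProduct, dotProduct_smul, smul_eq_mul, smul_eq_mul, mul_assoc]
        rw [hscale] at hle
        have hr2 : 0 < r * r := mul_pos hr0 hr0
        calc v₀ ⬝ᵥ (M *ᵥ v₀) * (v ⬝ᵥ v) = v₀ ⬝ᵥ (M *ᵥ v₀) * (r * r) := by rw [hrr]
          _ ≤ r⁻¹ * r⁻¹ * (v ⬝ᵥ (M *ᵥ v)) * (r * r) := mul_le_mul_of_nonneg_right hle hr2.le
          _ = v ⬝ᵥ (M *ᵥ v) := by field_simp
  · -- no unit vectors: the index type is empty, every vector is `0`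
    refine ⟨1, one_pos, fun v => ?_⟩
    by_cases hv : v ⬝ᵥ v = 0
    · have hv0 : v = 0 := dotProduct_self_eq_zero.1 hv
      rw [hv0, dotProduct_zero, Matrix.mulVec_zero, dotProduct_zero, mul_zero]
    · exfalso
      have hpos : 0 < v ⬝ᵥ v := lt_of_le_of_ne (dotProduct_self_nonneg' v) (Ne.symm hv)
      set r := Real.sqrt (v ⬝ᵥ v)
      have hrr : r * r = v ⬝ᵥ v := Real.mul_self_sqrt hpos.le
      have hr0 : 0 < r := Real.sqrt_pos.2 hpos
      refine hKe ⟨r⁻¹ • v, ?_⟩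
      show (r⁻¹ • v) ⬝ᵥ (r⁻¹ • v) = 1
      rw [smul_dotProduct, dotProduct_smul, smul_eq_mul, smul_eq_mul, ← hrr]
      field_simp

/-- **THE CELL OPERATORS ARE POSITIVE DEFINITE FOR EVERY `m² ≥ 0`, `a′ > 0`** when the transporters are the
parallel transports along contours `Γ_{y,x}` that run through positively weighted bonds INSIDE THE BLOCK `B^k(y)`, start
at a base site of the block and end at `x`, the links are orthogonal on weighted bonds and the block weights cover the
sites — p35's `B4Eq16GreenExists.covOp_posDef` on the cell (a union of whole blocks, so the contours stay in it).
[cite: Balaban1983RegularityDecay, (1.6) p.572, (1.8) p.573] -/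
theorem cell_posDef (Ω : Finset (Fin (d + 1) → ℤ)) (blk : X → ↥Ω) {c : X → X → ℝ} (hc : ∀ x x', 0 ≤ c x x')
    {m2 a' : ℝ} (hm : 0 ≤ m2) (ha' : 0 < a') {q : ↥Ω → X → ℝ} (hq0 : ∀ y x, 0 ≤ q y x)
    (hq : ∀ y x, q y x ≠ 0 → blk x = y) (hcov : ∀ x, ∃ y, 0 < q y x) {W : X → X → Matrix ι ι ℝ}
    (hW : ∀ x y, 0 < c x y → (W x y)ᵀ * W x y = 1) {emb : ↥Ω → X} {Γ : ↥Ω → X → List X}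
    {T : ↥Ω → X → Matrix ι ι ℝ} (hT : ∀ y x, q y x ≠ 0 → T y x = contourTrans W emb Γ y x)
    (hemb : ∀ y, blk (emb y) = y)
    (hpath : ∀ y x, q y x ≠ 0 → PathRel (fun u v => 0 < c u v ∧ blk v = y) (emb y) (Γ y x))
    (hend : ∀ y x, q y x ≠ 0 → pathEnd (emb y) (Γ y x) = x) (j : Fin (d + 1) × Bool) (i : ↥Ω) :
    (covOp (cR (lab Ω j ∘ blk) c i) m2 a' (qR (lab Ω j ∘ blk) (lab Ω j) q i) (WR (lab Ω j ∘ blk) W i)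
      (TR (lab Ω j ∘ blk) (lab Ω j) T i)).PosDef := by
  classical
  set cellX : X → ↥Ω := lab Ω j ∘ blk with hcellX
  set cellY : ↥Ω → ↥Ω := lab Ω j with hcellY
  -- sites of the weighted contours lie in the cell of their block
  have hin : ∀ (y : YC cellY i) (x : X), q y.1 x ≠ 0 → ∀ z ∈ Γ y.1 x, cellX z = i := by
    intro y x hyx z hz
    have hb : blk z = y.1 := forall_mem_of_pathRel _ _ (hpath y.1 x hyx) z hz
    show lab Ω j (blk z) = i
    rw [hb]; exact y.2
  have hembin : ∀ y : YC cellY i, cellX (emb y.1) = i := fun y => by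
    show lab Ω j (blk (emb y.1)) = i
    rw [hemb]; exact y.2
  -- the restricted base sites and contours
  let embR : YC cellY i → XC cellX i := fun y => ⟨emb y.1, hembin y⟩
  let ΓR : YC cellY i → XC cellX i → List (XC cellX i) := fun y x =>
    if h : q y.1 x.1 ≠ 0 then (Γ y.1 x.1).pmap Subtype.mk (hin y x.1 h) else []
  have hTR : ∀ (y : YC cellY i) (x : XC cellX i), qR cellX cellY q i y x ≠ 0 →
      TR cellX cellY T i y x = contourTrans (WR cellX W i) embR ΓR y x := by
    intro y x hyx
    have hyx' : q y.1 x.1 ≠ 0 := hyx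
    show T y.1 x.1 = transport (fun u v : XC cellX i => W u.1 v.1) (embR y) (ΓR y x)
    simp only [ΓR, dif_pos hyx']
    rw [hT _ _ hyx', contourTrans, transport_pmap]
  rw [covOp_congr m2 a' (fun _ _ _ => rfl) hTR]
  refine covOp_posDef (fun x y => hc _ _) hm ha' (fun y x => hq0 _ _) (fun x => ?_) (fun x y h => hW _ _ h)
    (fun y x hyx => ?_) (fun y x hyx => ?_)
  · -- cover
    obtain ⟨y, hy⟩ := hcov x.1
    have hyc : cellY y = i := by
      have hb : blk x.1 = y := hq y x.1 (ne_of_gt hy)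
      show lab Ω j y = i
      rw [← hb]; exact x.2
    exact ⟨⟨y, hyc⟩, hy⟩
  · -- weighted steps
    have hyx' : q y.1 x.1 ≠ 0 := hyx
    simp only [ΓR, dif_pos hyx']
    rw [pathRel_pmap_iff (r := fun u v => 0 < c u v)]
    exact pathRel_mono (fun u v huv => huv.1) _ _ (hpath _ _ hyx')
  · -- end point
    have hyx' : q y.1 x.1 ≠ 0 := hyx
    apply Subtype.ext
    simp only [ΓR, dif_pos hyx']
    rw [val_pathEnd_pmap]
    exact hend _ _ hyx'

/-- **(4.6) AS PRINTED, HYPOTHESIS-FREE ON EVERY CARRIER WITH BLOCK-INTERNAL CONTOURS** (every `m² ≥ 0`, `a_k > 0`,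
`s > 0`): the (1.8)-positivity of the `2(d+1)·|Ω|` cell operators comes from `cell_posDef` with one common constant
(`exists_pos_mul_le_form_of_posDef`, finitely many cells). [cite: Balaban1983RegularityDecay, (4.6) p.590] -/
theorem ineq46_printed_of_contours (Ω : Finset (Fin (d + 1) → ℤ)) (blk : X → ↥Ω) {c : X → X → ℝ}
    (hc : ∀ x x', 0 ≤ c x x') {m2 a s : ℝ} (hm : 0 ≤ m2) (ha : 0 < a) (hs : 0 < s) {q : ↥Ω → X → ℝ}
    (hq0 : ∀ y x, 0 ≤ q y x) (hq : ∀ y x, q y x ≠ 0 → blk x = y) (hcov : ∀ x, ∃ y, 0 < q y x)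
    {W : X → X → Matrix ι ι ℝ} (hW : ∀ x y, 0 < c x y → (W x y)ᵀ * W x y = 1) {emb : ↥Ω → X}
    {Γ : ↥Ω → X → List X} {T : ↥Ω → X → Matrix ι ι ℝ} (hT : ∀ y x, q y x ≠ 0 → T y x = contourTrans W emb Γ y x)
    (hemb : ∀ y, blk (emb y) = y)
    (hpath : ∀ y x, q y x ≠ 0 → PathRel (fun u v => 0 < c u v ∧ blk v = y) (emb y) (Γ y x))
    (hend : ∀ y x, q y x ≠ 0 → pathEnd (emb y) (Γ y x) = x) (ψ : ↥Ω × ι → ℝ) :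
    (2 * ((d : ℝ) + 1))⁻¹ * ∑ b ∈ bonds Ω, bondTerm Ω blk c m2 a s q W T b ψ
      ≤ ψ ⬝ᵥ (keff c m2 a s q W T *ᵥ ψ) := by
  classical
  -- one constant for the finitely many cells
  have hcell : ∀ p : (Fin (d + 1) × Bool) × ↥Ω, ∃ γ : ℝ, 0 < γ ∧ ∀ v, γ * (v ⬝ᵥ v) ≤
      v ⬝ᵥ (covOp (cR (lab Ω p.1 ∘ blk) c p.2) m2 (a * s) (qR (lab Ω p.1 ∘ blk) (lab Ω p.1) q p.2)
        (WR (lab Ω p.1 ∘ blk) W p.2) (TR (lab Ω p.1 ∘ blk) (lab Ω p.1) T p.2) *ᵥ v) := fun p =>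
    exists_pos_mul_le_form_of_posDef
      (cell_posDef Ω blk hc hm (mul_pos ha hs) hq0 hq hcov hW hT hemb hpath hend p.1 p.2)
  choose g hg using hcell
  by_cases hΩ : Ω.Nonempty
  · obtain ⟨y₀, hy₀⟩ := hΩ
    have hne : (Finset.univ : Finset ((Fin (d + 1) × Bool) × ↥Ω)).Nonempty := ⟨((0, true), ⟨y₀, hy₀⟩), Finset.mem_univ _⟩
    obtain ⟨p₀, _, hp₀⟩ := Finset.exists_min_image Finset.univ g hne
    refine ineq46_printed Ω blk hc hm ha.le hs.le hq W T (hg p₀).1 (fun j i v => ?_) ψ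
    exact le_trans (mul_le_mul_of_nonneg_right (hp₀ (j, i) (Finset.mem_univ _)) (dotProduct_self_nonneg' v))
      ((hg (j, i)).2 v)
  · -- `Ω = ∅`: the cell index is empty, the positivity hypothesis vacuous
    have hY : IsEmpty ↥Ω := ⟨fun y => hΩ ⟨y.1, y.2⟩⟩
    exact ineq46_printed Ω blk hc hm ha.le hs.le hq W T one_pos (fun j i v => (hY.false i).elim) ψ

end CellPositivity

/-! ## §6. The model instance: [B4]'s region carrier `fineDom n Ω` with the staircase contours -/

section Model

variable {ι : Type} [Fintype ι] [DecidableEq ι]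

/-- the block map of the fine region `fineDom n Ω` onto its unit labels. [cite: Balaban1983RegularityDecay, (1.1) p.572, dictionary] -/
def rblk {n : ℕ} (hn : 1 ≤ n) (Ω : Finset (Fin (d + 1) → ℤ)) (x : ↥(fineDom n Ω)) : ↥Ω :=
  ⟨blk n x.1, (mem_fineDom hn).1 x.2⟩

/-- **(4.6) AS PRINTED ON [B4]'s LATTICE MODEL, HYPOTHESIS-FREE**: on every finite union `Ω = ⋃_{y ∈ Ω^{(k)}} B^k(y)` of
unit blocks of `ηℤ^{d+1}` (`n = η⁻¹ ≥ 1`) with the Neumann bond weights `regWt`, block weights `rBlkWt`, base corners and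
staircase contours `Γ_{y,x}`, for EVERY vector field `A`, every orthogonal flow `U`, coupling `κ`, `m² ≥ 0`, `a_k > 0`,
`s > 0` and every `φ`:
`(2(d+1))⁻¹ · Σ_{⟨x,x′⟩⊂Ω^{(k)}} [bond term of Δ(x,x′)] ≤ ⟨φ, Δ^{(k)}(Ω,A)φ⟩`. [cite: Balaban1983RegularityDecay, (4.6) p.590] -/
theorem ineq46_printed_region (F : OrthFlow ι) (κ : ℝ) {n : ℕ} (hn : 1 ≤ n) (Ω : Finset (Fin (d + 1) → ℤ))
    {m2 a s : ℝ} (hm : 0 ≤ m2) (ha : 0 < a) (hs : 0 < s) (A : (Fin (d + 1) → ℤ) → (Fin (d + 1) → ℤ) → ℝ)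
    (ψ : ↥Ω × ι → ℝ) :
    (2 * ((d : ℝ) + 1))⁻¹ * ∑ b ∈ bonds Ω,
        bondTerm Ω (rblk hn Ω) (regWt n (fineDom n Ω)) m2 a s (rBlkWt n Ω (fineDom n Ω))
          (fieldLink F κ fun u v : ↥(fineDom n Ω) => A u.1 v.1)
          (contourTrans (fieldLink F κ fun u v : ↥(fineDom n Ω) => A u.1 v.1) (rbaseEmb hn Ω) (rstairContour hn Ω))
          b ψ
      ≤ ψ ⬝ᵥ (keff (regWt n (fineDom n Ω)) m2 a s (rBlkWt n Ω (fineDom n Ω))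
          (fieldLink F κ fun u v : ↥(fineDom n Ω) => A u.1 v.1)
          (contourTrans (fieldLink F κ fun u v : ↥(fineDom n Ω) => A u.1 v.1) (rbaseEmb hn Ω) (rstairContour hn Ω))
          *ᵥ ψ) := by
  refine ineq46_printed_of_contours Ω (rblk hn Ω) (regWt_nonneg n _) hm ha hs (rBlkWt_nonneg n Ω _)
    (fun y x h => Subtype.ext (rBlkWt_ne_zero h)) (rBlkWt_cover hn Ω) (fun x y _ => F.orth _)
    (fun y x _ => rfl) (fun y => Subtype.ext (rbaseEmb_blk hn Ω y)) (fun y x _ => ?_)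
    (fun y x h => rstairContour_end hn Ω y x h) ψ
  refine pathRel_mono (fun u v huv => ⟨?_, Subtype.ext huv.2⟩) _ _ (rstairContour_path hn Ω y x)
  have hn' : (0 : ℝ) < n := by exact_mod_cast hn
  simp only [regWt, if_pos huv.1, mul_one]
  positivity

end Model

end

end Literature.MathematicalPhysics.QuantumFieldTheory.Balaban1983to89.B4Ineq46Lattice
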